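import Summits.BirchSwinnertonDyer.Rank1Residual.X11b.Three.CornerResidual
import Summits.BirchSwinnertonDyer.Rank1Residual.Partition.Rows
import Literature.NumberTheory.EllipticCurves.GreenbergSelmer
import Literature.NumberTheory.EllipticCurves.Wuthrich2014.IntegralPAdicLFunctionMultiplicative
import Literature.NumberTheory.EllipticCurves.Rank1Residual.Typed.Basic
import HarnessLib

/-!
# Route `ClassRecordThree` (rung K2@3), crux 7 `CornerAtThree` (item stmt-BirchSwinnertonDyer-19111, shared with
# `KolyvaginRoadThree`): the objects a GLUED SPLIT posits — the two untouched conjuncts (StepL, Upper) and the two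
# halves of the twist conjunct (Tw) (TwistLower, TwistMu), plus TwistMu's ANALYTIC form TwistMuAn — as Theses-free
# `Prop` constants (cell `bsd-stepL`, seat `bsd-stepL-corner-p1` g6; planner g28 ruling (B) «same template for (Tw)@3
# on 19111»; `--supports stmt-BirchSwinnertonDyer-19111`)

This module imports NO Theses file (import closure checked: 0 Theses modules), so BOTH route files wanting 19111
(`Theses/ClassRecordThree.lean`, `Theses/KolyvaginRoadThree.lean`) may import it and type the children BY NAME.
The glues `cornerAtThree_of_branches` ∕ `cornerAtThree_of_branchesAn` live in the sibling
`Theorems/ClassRecordThreeCornerAtThreeBranches.lean` (which imports the route file to conclude the parent BY NAME).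

THE CRUX (item 19111): `CornerAtThree := ∀ W, Three.CornerStepLAt W ∧ Three.CornerTwistAt W ∧ Three.CornerUpperAt W`
— the non-surjective corner at `3` (`(E,3) ∈ X11b`, `ρ̄_{E,3}` not onto): STEP L on corner frames, the twist supply
(`BSD(E^{(d_K)},3)` of the rank-0 odd Heegner twins) and the Tamagawa-sharp upper bound. The seat's g2–g5 kernel
(`Theorems/ClassRecordThreeCornerAtThree*.lean`) reduces the TWIST conjunct: modulo six named facts of the twin's
rational Kato layer + engine pubs, `CornerTwistAt W ⟸ [MissingLowerBoundAt at every odd Heegner twin] ∧ [μ = 0 at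
every such twin]` (`X11b.cornerTwistAt_of_lowerTwists_of_katoFacts_of_mu_eq_zero`, p479217). So the children are:

* **`CornerAtThreeStepL`** = `∀ W, Three.CornerStepLAt W` (conjunct 1, verbatim by name);
* **`CornerAtThreeUpper`** = `∀ W, Three.CornerUpperAt W` (conjunct 3, verbatim by name);
* **`CornerAtThreeTwistLower`** = the main-conjecture ∕ Eisenstein half `Typed.MissingLowerBoundAt Wd 3` at every
  odd Heegner twin `Wd = Cd • E^{(d_K)}` of a corner pair (the `hlow` binder of p479217 verbatim; rung K2@3's sister
  object on class X11a at `3`);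
* **`CornerAtThreeTwistMu`** = Greenberg's `μ = 0` for the cyclotomic Selmer dual of every such twin at `3` (the `hμ`
  binder of p479217 verbatim; LNM 1716 Conj. 1.11 at a non-surjective irreducible image, `3 ∥ N`);
* **`CornerAtThreeTwistMuAn`** = its ANALYTIC form: at every such twin SOME coefficient of the Néron-normalised
  Mazur–Tate–Teitelbaum function `ϖ·L` is a `3`-adic unit (rung K6's `AnalyticMuZeroX9` ∕ N2's
  `AnalyticMuZeroOnClassX10b` shape read at `3 ∥ N`; PER PAIR a finite exact modular-symbol certificate). It implies
  `CornerAtThreeTwistMu` through the Kato `μ`-transfer WITHOUT big image at a multiplicative odd prime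
  (`X11b.MultMu.mu_eq_zero_of_multFine`, this seat, p487898 — prime-uniform, `p = 3` included) modulo the
  construction fact `Kato2004.exists_multDivisibilityInputs_fine` (p487500).

HONEST FRAMING: five `Prop` constants (restrictions ∕ companions of an OPEN crux; NOTHING asserted); no named fact
minted here, no theorem, no `sorry`; the split is lossless on conjuncts 1 and 3 and SUFFICIENT on (Tw); BSD is not
advanced; item 19111 stays open; no census word, tier or label moves (T7).

References: [GreenbergLNM1716] §1 Conj. 1.11 (p. 61); [Wuthrich2014] Cor. 18, Prop. 21 (p. 398); [Kato2004Asterisque]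
Thm. 12.4–12.6, §17.13; [MatarNekovar2019] Thm. 0.3, §0.11; [Cha2005] Thm. 21; [SteinWuthrich2013] Thm. 6.1;
[MazurTateTeitelbaum1986] §I.10, §I.14; tree: `X11b/Three/CornerResidual.lean` (x11b3), `Theorems/ClassRecordThreeCornerAtThreeTwinKatoFacts.lean` (p479217).
-/

set_option autoImplicit false
set_option linter.dupNamespace false

noncomputable section

open scoped Classical NumberField MatrixGroups ModularForm

open CongruenceSubgroup WeierstrassCurve NumberField IsDedekindDomain Field
  Literature.NumberTheory.EllipticCurves
  Literature.NumberTheory.EllipticCurves.ModularForms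
  Literature.NumberTheory.EllipticCurves.Rank1Residual
  Literature.NumberTheory.EllipticCurves.Rank1Residual.Typed
  Literature.NumberTheory.QuadraticFields.Quadratic
  Summit.BirchSwinnertonDyer.Rank1Residual
  Summit.BirchSwinnertonDyer.Rank1Residual.X11b.Three

namespace Summit.BirchSwinnertonDyer.BirchSwinnertonDyer.Theorems

/-- [crux branch StepL of item 19111 `CornerAtThree`] **STEP L on the (T4″)@3 corner, conjunct 1 of the crux BY
NAME**: `∀ W, Three.CornerStepLAt W` (one inclusion of the anticyclotomic main conjecture at `𝟙` on every odd-`d_K`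
Manin-good Heegner frame of a corner pair at `3`; x11b3's typed open input). A `Prop` constant; OPEN; nothing
asserted. [cite: GreenbergLNM1716, §1 (shape only; nothing asserted)] -/
@[conjecture]
def CornerAtThreeStepL : Prop :=
  ∀ (W : WeierstrassCurve ℚ) [W.IsElliptic] [W.IsGloballyMinimal], CornerStepLAt W

/-- [crux branch Upper of item 19111 `CornerAtThree`] **the Tamagawa-SHARP Kolyvagin bound over `K` on the
(T4″)@3 corner, conjunct 3 of the crux BY NAME**: `∀ W, Three.CornerUpperAt W`. A `Prop` constant; OPEN; nothing
asserted. [cite: MatarNekovar2019, Thm. 0.3 (p. 456) (the unsharp printed form; shape only)] -/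
@[conjecture]
def CornerAtThreeUpper : Prop :=
  ∀ (W : WeierstrassCurve ℚ) [W.IsElliptic] [W.IsGloballyMinimal], CornerUpperAt W

/-- [crux branch TwistLower of item 19111 `CornerAtThree`] **the main-conjecture ∕ Eisenstein half at every odd
Heegner twin of a corner pair at `3`**: for `(E,3) ∈ X11b` with `ρ̄_{E,3}` not onto, `K` imaginary quadratic with odd
`d_K` satisfying the Heegner hypothesis for `N_E`, `L(E^{(d_K)},1) ≠ 0`, and every globally minimal model
`Wd = Cd • E^{(d_K)}`: `Typed.MissingLowerBoundAt Wd 3` (`ord₃ #Ш(Wd)_an ≤ ord₃ #Ш(Wd)`). Verbatim the `hlow` binder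
of `X11b.cornerTwistAt_of_lowerTwists_of_katoFacts_of_mu_eq_zero` (p479217). A `Prop` constant; OPEN; nothing
asserted. [cite: Skinner2016PacificMC, Thm. C (§1) (the printed road needs a (ram) prime; shape only)] -/
@[conjecture]
def CornerAtThreeTwistLower : Prop :=
  ∀ (W : WeierstrassCurve ℚ) [W.IsElliptic] [W.IsGloballyMinimal] (K : Type) [Field K] [NumberField K]
    (Wd : WeierstrassCurve ℚ) [Wd.IsElliptic] [Wd.IsGloballyMinimal] (Cd : VariableChange ℚ),
    ClassX11b W 3 → ¬ Surj W 3 → IsImaginaryQuadratic K → Odd (NumberField.discr K) →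
    SatisfiesHeegnerHypothesis (W.conductorNorm ℤ) K →
    (W.quadraticTwist (NumberField.discr K : ℚ)).entireLFunction 1 ≠ 0 →
    Cd • W.quadraticTwist (NumberField.discr K : ℚ) = Wd → Typed.MissingLowerBoundAt Wd 3

/-- [crux branch TwistMu of item 19111 `CornerAtThree`] **Greenberg's `μ = 0` at every odd Heegner twin of a
corner pair at `3` (literal shape)**: for `W, K, Wd, Cd` as in `CornerAtThreeTwistLower`, every cyclotomic `(κ, γ)`
at `3` and every Selmer dual datum `D` of `Sel_{3^∞}(Wd/ℚ_∞)`: `μ(X) = 0`. Verbatim the `hμ` binder of p479217;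
Greenberg's Conj. 1.11 at an irreducible NON-surjective image and `3 ∥ N`. A `Prop` constant; OPEN; nothing asserted.
[cite: GreenbergLNM1716, §1 Conj. 1.11 (p. 61) and p. 121 (shape only; nothing asserted)] -/
@[conjecture]
def CornerAtThreeTwistMu : Prop :=
  ∀ (W : WeierstrassCurve ℚ) [W.IsElliptic] [W.IsGloballyMinimal] (K : Type) [Field K] [NumberField K]
    (Wd : WeierstrassCurve ℚ) [Wd.IsElliptic] [Wd.IsGloballyMinimal] (Cd : VariableChange ℚ),
    ClassX11b W 3 → ¬ Surj W 3 → IsImaginaryQuadratic K → Odd (NumberField.discr K) →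
    SatisfiesHeegnerHypothesis (W.conductorNorm ℤ) K →
    (W.quadraticTwist (NumberField.discr K : ℚ)).entireLFunction 1 ≠ 0 →
    Cd • W.quadraticTwist (NumberField.discr K : ℚ) = Wd →
    ∀ (κ : ZpExtension ℚ 3) (γ : Field.absoluteGaloisGroup ℚ),
      κ.IsCyclotomic → κ.IsTopGenerator γ → IsCyclotomicVariable 3 γ →
      ∀ D : Wd.SelmerDualData κ γ, D.mu = 0

/-- [crux branch TwistMuAn of item 19111 `CornerAtThree` — the ANALYTIC form of TwistMu] **analytic `μ = 0` at
every odd Heegner twin of a corner pair at `3`**: for `W, K, Wd, Cd` as in `CornerAtThreeTwistLower`, every newform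
`f` of `Wd`, the period ratio `ϖ` (`ϖ·Ω_{Wd} = Ω⁺_f`) and every Mazur–Tate–Teitelbaum function `L` of `f` at `3`
with allowable root `a = a_3 = ±1` (`IsMultPAdicLFunctionOf f 3 a L`): SOME coefficient of `ϖ·L` is a `3`-adic
unit (`ϖ·L ∈ Λ` by Wuthrich 2014 Cor. 18). N2's `AnalyticMuZeroOnClassX10b` shape at `3 ∥ N`; PER PAIR a finite
exact modular-symbol certificate; class-wide Greenberg's Conj. 1.11 through the main conjecture. A `Prop` constant;
OPEN; nothing asserted. [cite: GreenbergLNM1716, §1 Conj. 1.11 (p. 61) (shape only; nothing asserted)]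
[cite: Wuthrich2014, Cor. 18 (p. 398)] [cite: MazurTateTeitelbaum1986, §I.10 and §I.14 (allowable root a_p at p ∥ N)] -/
@[conjecture]
def CornerAtThreeTwistMuAn : Prop :=
  ∀ (W : WeierstrassCurve ℚ) [W.IsElliptic] [W.IsGloballyMinimal] (K : Type) [Field K] [NumberField K]
    (Wd : WeierstrassCurve ℚ) [Wd.IsElliptic] [Wd.IsGloballyMinimal] (Cd : VariableChange ℚ),
    ClassX11b W 3 → ¬ Surj W 3 → IsImaginaryQuadratic K → Odd (NumberField.discr K) →
    SatisfiesHeegnerHypothesis (W.conductorNorm ℤ) K →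
    (W.quadraticTwist (NumberField.discr K : ℚ)).entireLFunction 1 ≠ 0 →
    Cd • W.quadraticTwist (NumberField.discr K : ℚ) = Wd →
    ∀ {N : ℕ} [NeZero N] (f : CuspForm (Gamma0 N) 2), IsNewformOf Wd f →
    ∀ (ϖ : ℚ), (ϖ : ℝ) * Wd.realPeriodRat = plusPeriod f →
    ∀ (a : ℚ_[3]) (L : PowerSeries ℚ_[3]),
      (Wd.HasSplitMultiplicativeReductionAtPrime 3 → a = 1) →
      (¬ Wd.HasSplitMultiplicativeReductionAtPrime 3 → a = -1) →
      IsMultPAdicLFunctionOf f 3 a L →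
      ∃ n : ℕ, ‖PowerSeries.coeff n (PowerSeries.C ((ϖ : ℚ) : ℚ_[3]) * L)‖ = 1

end Summit.BirchSwinnertonDyer.BirchSwinnertonDyer.Theorems

end
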